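import Literature.Geometry.Manifold.LocalDeRhamExternalProduct
import Literature.Geometry.Manifold.DeRhamComparison
import Literature.AlgebraicTopology.SingularHomology.CupRightPullback
import HarnessLib

/-!
# The two sides of the multiplicativity of the de Rham comparison, for an external product

For `C^∞` manifolds `M` (model `I`) and `N` (model `I'`) — Hausdorff, second countable, finite
dimensional, without boundary — a closed smooth `l`-form `β` on `N` and an open set `W ⊆ M`, we
set up the two maps `Hᵏ(Ω•(W)) → Hⁿ_{M × N}(π₁⁻¹ W; ℝ)` (`k + l = n`; `H^•_X(V)` the cohomology of
the cochains of `X` on the singular chains with image in `V`, `subsetCochains`) whose equality IS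
the multiplicativity `[π₁^* η ∧ π₂^* β] ↦ π₁^*[η] ⌣ π₂^*[β]` of the integration comparison of
de Rham's theorem (Bredon (1993), Thm. V.9.5; Bott–Tu (1982), §I.5, the maps `π^*(·) ∧ ρ^* φ` of the
Künneth formula):

* `lhs W a = Ψ'_{π₁⁻¹ W} [π₁^* η ∧ π₂^* β]` — the comparison (`localDeRhamToSubset`, integration over
  smooth simplices followed by the inverse of "restriction to smooth chains") of the external
  product `extProdH` (`LocalDeRhamExternalProduct.lean`);
* `rhs W a = π₁^*(Ψ'_W [η]) ⌣ b_β` — the pull-back to `π₁⁻¹ W` of the comparison of `[η]`, cup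
  (`SimplexSpan.cupRightH`) the global singular cocycle `b_β = π₂^♯ b` of `M × N`, where `b` is a
  cocycle of `N` representing `Ψ'_N [β]` and chosen (`goodRep`) so that ITS RESTRICTION TO SMOOTH
  SIMPLICES IS EXACTLY INTEGRATION OF `β` (`toSmooth_goodRep`; possible because restriction of
  cochains to smooth chains is onto, `toSmooth_f_surjective`, and a cohomology isomorphism).

PROVED here: both sides commute with restriction to smaller open sets (`lhs_res`, `rhs_res`), with
the Mayer–Vietoris connecting homomorphisms (`lhs_δ`, `rhs_δ`), with `C^∞` maps `f : M₁ → M` into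
`W` in the first factor (`lhs_pullbackInto`, `rhs_pullbackInto`) and with `C^∞` maps in the
second factor (`lhs_pullbackInto_snd`, `rhs_pullbackInto_snd`).  These are the formal properties
driving the Mayer–Vietoris induction of Bredon's proof of the multiplicativity of the de Rham
isomorphism (Bredon (1993), Thm. V.9.5 with §VI.3–4 (cross products); Bott–Tu (1982), §I.5).
Also: the smooth simplices in `W` as a front/back-closed simplex span (`smoothSpan`).

Everything is proved; no named facts.

## References

* [Bredon1993] G. E. Bredon, *Topology and Geometry*, GTM 139 (1993), §V.5, §V.9 Thm. V.9.5.
* [BottTu1982Forms] R. Bott, L. W. Tu, *Differential Forms in Algebraic Topology* (1982), §I.5.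
* [HatcherAT2002] A. Hatcher, *Algebraic Topology*, CUP 2002, §3.2 Prop. 3.10, Lemma 3.6.
-/

noncomputable section

-- see "Implementation notes" in `…SingularHomology.SingularChainsConcrete`
set_option backward.isDefEq.respectTransparency false

open scoped Manifold ContDiff Topology
open CategoryTheory Limits Set Literature.AlgebraicTopology.SingularHomology Literature.Geometry.Kaehler

universe u

/-! ### Front and back faces of smooth simplices -/

namespace Literature.AlgebraicTopology.SingularHomology.SingularSimplex

variable {X : Type u} [TopologicalSpace X] {p q n : ℕ}

/-- The front face is the composite with the affine simplex on the first vertices. [folklore] -/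
theorem frontFace_eq_compose_subinterval (h : p ≤ n) (σ : SingularSimplex X n) :
    σ.frontFace h = σ.compose (fun j ↦ stdSimplex.vertex
      ((SimplexCategory.subinterval 0 p (by omega)).toOrderHom j)) := by
  apply toContinuousMap_injective
  rw [toContinuousMap_compose]
  change (toContinuousMap σ).comp ⟨stdSimplex.map ⇑(SimplexCategory.subinterval 0 p (by omega)).toOrderHom,
    stdSimplex.continuous_map _⟩ = _
  congr 1
  ext t : 1
  exact StdSimplex.stdSimplex_map_eq_affComb _ t

/-- The back face is the composite with the affine simplex on the last vertices. [folklore] -/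
theorem backFace_eq_compose_subinterval (h : q ≤ n) (σ : SingularSimplex X n) :
    σ.backFace h = σ.compose (fun j ↦ stdSimplex.vertex
      ((SimplexCategory.subinterval (n - q) q (by omega)).toOrderHom j)) := by
  apply toContinuousMap_injective
  rw [toContinuousMap_compose]
  change (toContinuousMap σ).comp ⟨stdSimplex.map ⇑(SimplexCategory.subinterval (n - q) q (by omega)).toOrderHom,
    stdSimplex.continuous_map _⟩ = _
  congr 1
  ext t : 1
  exact StdSimplex.stdSimplex_map_eq_affComb _ t

variable {E : Type*} [NormedAddCommGroup E] [NormedSpace ℝ E] {H : Type*} [TopologicalSpace H]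
  {I : ModelWithCorners ℝ E H} {M : Type u} [TopologicalSpace M] [ChartedSpace H M]

/-- **Front faces of smooth simplices are smooth** (affine reparametrisation). [cite: LeeSmoothManifolds2013, Ch. 18 p. 474] -/
theorem IsSmooth.frontFace {σ : SingularSimplex M n} (hσ : σ.IsSmooth I) (h : p ≤ n) :
    (σ.frontFace h).IsSmooth I := by
  rw [frontFace_eq_compose_subinterval]
  exact hσ.compose _

/-- **Back faces of smooth simplices are smooth** (affine reparametrisation). [cite: LeeSmoothManifolds2013, Ch. 18 p. 474] -/
theorem IsSmooth.backFace {σ : SingularSimplex M n} (hσ : σ.IsSmooth I) (h : q ≤ n) :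
    (σ.backFace h).IsSmooth I := by
  rw [backFace_eq_compose_subinterval]
  exact hσ.compose _

end Literature.AlgebraicTopology.SingularHomology.SingularSimplex

namespace Literature.Geometry.Manifold

variable {E : Type u} [NormedAddCommGroup E] [NormedSpace ℝ E] {H : Type u} [TopologicalSpace H]
  {I : ModelWithCorners ℝ E H} {M : Type u} [TopologicalSpace M] [ChartedSpace H M]

/-! ### The smooth simplices in `W` as a simplex span -/

variable (I) in
/-- **The span of the smooth simplices with image in `W`**: its subcomplex is `Δ^{sm}(W)`
(`smoothChainsInSub`) and its cochains are the smooth cochains `smoothSubsetCochains`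
(Bredon (1993), §V.5). [cite: Bredon1993, §V.5] -/
def smoothSpan (W : Set M) : SimplexSpan ℝ M where
  carrier k := {σ | σ.IsSmooth I ∧ σ.range ⊆ W}
  face_mem' hτ i := ⟨hτ.1.face i, face_mem_simplicesIn hτ.2 i⟩
  sub := smoothChainsInSub I ℝ ℝ M W
  mem_sub_iff' c := by
    rw [mem_smoothChainsInSub_iff_forall I c]
    exact ⟨fun h σ hσ ↦ h σ hσ, fun h σ hσ ↦ h hσ⟩

/-- Membership in the smooth span. [folklore] -/
@[simp] theorem mem_smoothSpan_carrier {W : Set M} {k : ℕ} (σ : SingularSimplex M k) :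
    σ ∈ (smoothSpan I W).carrier k ↔ σ.IsSmooth I ∧ σ.range ⊆ W := Iff.rfl

/-- The subcomplex of the smooth span. [folklore] -/
@[simp] theorem smoothSpan_sub (W : Set M) : (smoothSpan I W).sub = smoothChainsInSub I ℝ ℝ M W := rfl

/-- The cochains of the smooth span are the smooth cochains of `W`. [folklore] -/
theorem smoothSpan_cochains (W : Set M) :
    (smoothSpan I W).cochains = smoothSubsetCochains I ℝ realCoeff.{u} M W := rfl

/-- The smooth span is closed under front and back faces. [folklore] -/
theorem frontBackClosed_smoothSpan (W : Set M) : (smoothSpan I W).FrontBackClosed where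
  front h _ hσ := ⟨hσ.1.frontFace h, (SingularSimplex.range_frontFace_subset h _).trans hσ.2⟩
  back h _ hσ := ⟨hσ.1.backFace h, (SingularSimplex.range_backFace_subset h _).trans hσ.2⟩

/-- Restriction to smooth chains is restriction from the span `C(W)` to the smooth span. [folklore] -/
theorem toSmooth_f_apply {W : Set M} (k : ℕ) (ψ : (subsetCochains ℝ realCoeff.{u} W).X k) :
    (smoothSubsetCochains.toSmooth I ℝ realCoeff.{u} W).f k ψ =
      (Subcomplex.incl (smoothChainsInSub_le_chainsInSub (I := I) (R := ℝ) (A := ℝ) W)).f k ≫ ψ :=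
  rfl

/-- **Restriction to smooth chains commutes with `⌣ b`** (`toSmooth (ψ ⌣ b) = toSmooth ψ ⌣ b`, the
latter cup product in the smooth span). [cite: HatcherAT2002, §3.2 Prop. 3.10] -/
theorem toSmooth_cupRight {W : Set M} {p d n : ℕ} (b : SingularSimplex M d → ℝ) (h : p + d = n)
    (ψ : (subsetCochains ℝ realCoeff.{u} W).X p) :
    (smoothSubsetCochains.toSmooth I ℝ realCoeff.{u} W).f n ((SimplexSpan.ofSet (R := ℝ) W).cupRight b h ψ) =
      (smoothSpan I W).cupRight b h ((smoothSubsetCochains.toSmooth I ℝ realCoeff.{u} W).f p ψ) := by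
  rw [toSmooth_f_apply, toSmooth_f_apply]
  exact (SimplexSpan.ofSet (R := ℝ) W).incl_cupRight (smoothSpan I W)
    (smoothChainsInSub_le_chainsInSub (I := I) (R := ℝ) (A := ℝ) W) (frontBackClosed_smoothSpan W)
    (fun hσ ↦ hσ.2) b h ψ

/-- The function cochain of the restriction to smooth chains, on a smooth simplex in `W`. [folklore] -/
theorem toFun_toSmooth {W : Set M} {k : ℕ} (ψ : (subsetCochains ℝ realCoeff.{u} W).X k)
    {σ : SingularSimplex M k} (hσ : σ ∈ (smoothSpan I W).carrier k) :
    (smoothSpan I W).toFun ((smoothSubsetCochains.toSmooth I ℝ realCoeff.{u} W).f k ψ) σ =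
      (SimplexSpan.ofSet (R := ℝ) W).toFun ψ σ := by
  rw [toSmooth_f_apply]
  exact (SimplexSpan.ofSet (R := ℝ) W).toFun_incl (smoothSpan I W)
    (smoothChainsInSub_le_chainsInSub (I := I) (R := ℝ) (A := ℝ) W) ψ hσ hσ.2

/-- `toFun` of a difference. [folklore] -/
theorem _root_.Literature.AlgebraicTopology.SingularHomology.SimplexSpan.toFun_sub {X : Type u} [TopologicalSpace X]
    (𝒮 : SimplexSpan ℝ X) {p : ℕ} (ψ ψ' : 𝒮.sub.toComplex.X p ⟶ SimplexSpan.coefR ℝ) :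
    𝒮.toFun (ψ - ψ') = 𝒮.toFun ψ - 𝒮.toFun ψ' := by
  rw [sub_eq_add_neg, 𝒮.toFun_add, ← neg_one_smul ℝ ψ', 𝒮.toFun_smul, neg_one_smul, ← sub_eq_add_neg]

/-! ### Restriction of cochains to smooth chains is onto -/

/-- **Every cochain on the smooth chains in `W` extends to a cochain on all chains in `W`**
(extend by zero on the non-smooth simplices: the smooth simplices are part of a basis).
[cite: Bredon1993, §V.9] -/
theorem toSmooth_f_surjective (W : Set M) (j : ℕ) :
    Function.Surjective ((smoothSubsetCochains.toSmooth I ℝ realCoeff.{u} W).f j) := by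
  classical
  intro e
  -- the projection of a chain in `W` onto its smooth part
  have hmem : ∀ x : ↥(chainsInSub ℝ ℝ M W j),
      (x.1 : CChain ℝ M j).filter (fun σ : SingularSimplex M j ↦ σ.IsSmooth I) ∈ smoothChainsInSub I ℝ ℝ M W j := fun x ↦ by
    refine (mem_smoothChainsInSub_iff_forall I _).2 fun σ hσ ↦ ?_
    rw [Finsupp.support_filter, Finset.mem_filter] at hσ
    exact ⟨hσ.2, (mem_chainsIn_iff ℝ ℝ (x.1 : CChain ℝ M j)).1 x.2 σ hσ.1⟩
  let pr : ↥(chainsInSub ℝ ℝ M W j) →ₗ[ℝ] ↥(smoothChainsInSub I ℝ ℝ M W j) :=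
    { toFun := fun x ↦ ⟨(x.1 : CChain ℝ M j).filter (fun σ : SingularSimplex M j ↦ σ.IsSmooth I), hmem x⟩
      map_add' := fun x y ↦ Subtype.ext (by
        change ((x.1 : CChain ℝ M j) + y.1).filter _ = (x.1 : CChain ℝ M j).filter _ + (y.1 : CChain ℝ M j).filter _
        exact Finsupp.filter_add)
      map_smul' := fun r x ↦ Subtype.ext (by
        change (r • (x.1 : CChain ℝ M j)).filter _ = r • (x.1 : CChain ℝ M j).filter _
        exact Finsupp.filter_smul) }
  refine ⟨ModuleCat.ofHom (ModuleCat.Hom.hom e ∘ₗ pr), ?_⟩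
  rw [toSmooth_f_apply]
  refine ModuleCat.hom_ext (LinearMap.ext fun y ↦ ?_)
  rw [ModuleCat.comp_apply]
  change (ModuleCat.Hom.hom e) (pr ((Subcomplex.incl _).f j y)) = (ModuleCat.Hom.hom e) y
  congr 1
  apply Subtype.ext
  change ((Subcomplex.incl _).f j y).1.filter (fun σ : SingularSimplex M j ↦ σ.IsSmooth I) = y.1
  rw [Subcomplex.incl_f_apply_val]
  exact (Finsupp.filter_eq_self_iff _ _).2 fun σ hσ ↦
    ((mem_smoothChainsInSub_iff_forall I (y.1 : CChain ℝ M j)).1 y.2 σ (Finsupp.mem_support_iff.2 hσ)).1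

/-! ### Good representatives of the comparison classes of closed forms -/

section GoodRep

variable [IsManifold I ∞ M] [I.Boundaryless] [FiniteDimensional ℝ E] [T2Space M] [SecondCountableTopology M]
  [LocallyCompactSpace M] {l : ℕ}

/-- The class `Ψ'_M [β] ∈ H^l_M(univ)` of a closed form under the de Rham comparison. [folklore] -/
abbrev comparisonCls (β : closedSmoothForms I M ℝ l) : (subsetCochains ℝ realCoeff.{u} (univ : Set M)).homology l :=
  localDeRhamToSubset I (isOpen_univ : IsOpen (univ : Set M)) l (closedToLocalHomology I M ℝ l β)

/-- **A cocycle representing `Ψ'_M [β]` whose restriction to smooth simplices is integration of `β`.**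
Take any representative `b₀`; on smooth chains `b₀` and `∫ β` are cohomologous, `b₀|sm - ∫β = δy`;
extend `y` to all chains (`toSmooth_f_surjective`) and correct `b₀` by its coboundary.
[cite: Bredon1993, Thm. V.9.5] -/
theorem exists_goodRep (β : closedSmoothForms I M ℝ l) :
    ∃ (b : (subsetCochains ℝ realCoeff.{u} (univ : Set M)).X l)
      (hb : (subsetCochains ℝ realCoeff.{u} (univ : Set M)).d l ((ComplexShape.down ℕ).symm.next l) b = 0),
      homologyCls b hb = comparisonCls β ∧
        (smoothSubsetCochains.toSmooth I ℝ realCoeff.{u} univ).f l b =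
          (deRhamMap I (isOpen_univ : IsOpen (univ : Set M))).f l (closedToUniv I M ℝ l β) := by
  haveI : Fact (IsOpen (univ : Set M)) := ⟨isOpen_univ⟩
  set K := subsetCochains ℝ realCoeff.{u} (univ : Set M)
  set L := smoothSubsetCochains I ℝ realCoeff.{u} M (univ : Set M)
  set T := smoothSubsetCochains.toSmooth I ℝ realCoeff.{u} (univ : Set M)
  obtain ⟨b₀, hb₀, hc⟩ := homologyCls_surjective (comparisonCls β)
  -- on smooth chains, `b₀` and `Ψ β` have the same class
  have hΨ : L.d l ((ComplexShape.down ℕ).symm.next l) ((deRhamMap I isOpen_univ).f l (closedToUniv I M ℝ l β)) = 0 :=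
    d_hom_f_eq_zero _ _ (d_closedToUniv β)
  have hcls : homologyCls (T.f l b₀) (d_hom_f_eq_zero T b₀ hb₀) =
      homologyCls ((deRhamMap I isOpen_univ).f l (closedToUniv I M ℝ l β)) hΨ := by
    rw [← homologyMap_homologyCls T b₀ hb₀, hc, comparisonCls, ← ModuleCat.comp_apply,
      localDeRhamToSubset_comp_toSmooth]
    exact homologyMap_homologyCls _ _ _
  obtain ⟨y, hy⟩ := (homologyCls_eq_homologyCls_iff _ _ _ _).1 hcls
  obtain ⟨Y, hY⟩ := toSmooth_f_surjective (I := I) (univ : Set M) _ y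
  have hdY : K.d l ((ComplexShape.down ℕ).symm.next l) (K.d _ l Y) = 0 := by
    rw [← ModuleCat.comp_apply, HomologicalComplex.d_comp_d]
    rfl
  have hb : K.d l ((ComplexShape.down ℕ).symm.next l) (b₀ - K.d _ l Y) = 0 := by
    rw [map_sub, hb₀, hdY, sub_zero]
  refine ⟨b₀ - K.d _ l Y, hb, ?_, ?_⟩
  · rw [homologyCls_sub _ _ hb₀ hdY, hc, (homologyCls_eq_zero_iff _ hdY).2 ⟨Y, rfl⟩, sub_zero]
  · rw [map_sub]
    change T.f l b₀ - T.f l (K.d _ l Y) = _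
    rw [← ModuleCat.comp_apply, ← T.comm, ModuleCat.comp_apply, hY, hy, sub_sub_cancel]

/-- **A good representative of `Ψ'_M [β]`** (`exists_goodRep`). [cite: Bredon1993, Thm. V.9.5] -/
def goodRep (β : closedSmoothForms I M ℝ l) : (subsetCochains ℝ realCoeff.{u} (univ : Set M)).X l :=
  (exists_goodRep β).choose

/-- The good representative is a cocycle. [folklore] -/
theorem d_goodRep (β : closedSmoothForms I M ℝ l) :
    (subsetCochains ℝ realCoeff.{u} (univ : Set M)).d l ((ComplexShape.down ℕ).symm.next l) (goodRep β) = 0 :=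
  (exists_goodRep β).choose_spec.choose

/-- The good representative is a cocycle (form `l ↦ l + 1`). [folklore] -/
theorem d_goodRep' (β : closedSmoothForms I M ℝ l) :
    (subsetCochains ℝ realCoeff.{u} (univ : Set M)).d l (l + 1) (goodRep β) = 0 :=
  (d_next_eq_zero_iff (SimplexSpan.symm_down_next l) _).1 (d_goodRep β)

/-- The good representative represents `Ψ'_M [β]`. [folklore] -/
theorem homologyCls_goodRep (β : closedSmoothForms I M ℝ l) :
    homologyCls (goodRep β) (d_goodRep β) = comparisonCls β :=
  (exists_goodRep β).choose_spec.choose_spec.1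

/-- **On smooth chains the good representative is integration of `β`.** [cite: Bredon1993, Thm. V.9.5] -/
theorem toSmooth_goodRep (β : closedSmoothForms I M ℝ l) :
    (smoothSubsetCochains.toSmooth I ℝ realCoeff.{u} univ).f l (goodRep β) =
      (deRhamMap I (isOpen_univ : IsOpen (univ : Set M))).f l (closedToUniv I M ℝ l β) :=
  (exists_goodRep β).choose_spec.choose_spec.2

/-- **The function cochain `b_β` of the good representative**, a global singular cocycle of `M`. [folklore] -/
def goodFun (β : closedSmoothForms I M ℝ l) : SingularSimplex M l → ℝ :=
  (SimplexSpan.ofSet (R := ℝ) (univ : Set M)).toFun (goodRep β)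

/-- `b_β` is a singular cocycle. [folklore] -/
theorem d_goodFun (β : closedSmoothForms I M ℝ l) :
    (singularCochainComplex ℝ ℝ M).d l (l + 1) (goodFun β) = 0 := by
  funext τ
  have h1 := (SimplexSpan.ofSet (R := ℝ) (univ : Set M)).toFun_d (goodRep β) (τ := τ) (subset_univ _)
  have h2 : (SimplexSpan.ofSet (R := ℝ) (univ : Set M)).cochains.d l (l + 1) (goodRep β) = 0 := d_goodRep' β
  rw [h2, SimplexSpan.toFun_zero, Pi.zero_apply] at h1
  rw [Pi.zero_apply]
  exact h1.symm

/-- **The value of `b_β` on a smooth simplex is `∫_τ β`.** [cite: Bredon1993, Thm. V.9.5] -/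
theorem goodFun_apply_of_isSmooth (β : closedSmoothForms I M ℝ l) {τ : SingularSimplex M l} (hτ : τ.IsSmooth I) :
    goodFun β τ = τ.formIntegral (β.1 : MForm I M ℝ l) := by
  have hmem : τ ∈ (smoothSpan I (univ : Set M)).carrier l := ⟨hτ, subset_univ _⟩
  rw [goodFun, ← toFun_toSmooth _ hmem, toSmooth_goodRep, (smoothSpan I (univ : Set M)).toFun_apply_of_mem _ hmem]
  change cochainVal ((deRhamMap I isOpen_univ).f l (closedToUniv I M ℝ l β)) ⟨Finsupp.single τ 1, _⟩ = _
  rw [deRhamMap_cochainVal]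
  change integrationFunctional (β.1 : MForm I M ℝ l) (Finsupp.single τ 1) = _
  rw [integrationFunctional_single, one_mul]

end GoodRep

/-! ### The two sides -/

section Sides

variable [IsManifold I ∞ M] [I.Boundaryless] [FiniteDimensional ℝ E] [T2Space M] [SecondCountableTopology M]
  [LocallyCompactSpace M]
  {E' : Type u} [NormedAddCommGroup E'] [NormedSpace ℝ E'] {H' : Type u} [TopologicalSpace H']
  {I' : ModelWithCorners ℝ E' H'} {N : Type u} [TopologicalSpace N] [ChartedSpace H' N] [IsManifold I' ∞ N]
  [I'.Boundaryless] [FiniteDimensional ℝ E'] [T2Space N] [SecondCountableTopology N] [LocallyCompactSpace N]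
  {k l n : ℕ}

/-- The second projection of `M × N` as a continuous map. [folklore] -/
abbrev sndCM (M N : Type u) [TopologicalSpace M] [TopologicalSpace N] : C(M × N, N) := ⟨Prod.snd, continuous_snd⟩

/-- The first projection of `M × N` as a continuous map. [folklore] -/
abbrev fstCM (M N : Type u) [TopologicalSpace M] [TopologicalSpace N] : C(M × N, M) := ⟨Prod.fst, continuous_fst⟩

variable (M) in
/-- **The global cocycle `π₂^♯ b_β` of `M × N`** attached to a closed `l`-form `β` on `N`. [folklore] -/
def prodFun (β : closedSmoothForms I' N ℝ l) : SingularSimplex (M × N) l → ℝ :=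
  (singularCochainComplex.map ℝ ℝ (sndCM M N)).f l (goodFun β)

omit [IsManifold I ∞ M] [I.Boundaryless] [FiniteDimensional ℝ E] [T2Space M] [SecondCountableTopology M]
  [LocallyCompactSpace M] in
/-- `π₂^♯ b_β` is a cocycle. [folklore] -/
theorem d_prodFun (β : closedSmoothForms I' N ℝ l) :
    (singularCochainComplex ℝ ℝ (M × N)).d l (l + 1) (prodFun M β) = 0 :=
  subsetCochains.map_d_eq_zero _ _ (d_goodFun β)

omit [IsManifold I ∞ M] [I.Boundaryless] [FiniteDimensional ℝ E] [T2Space M] [SecondCountableTopology M]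
  [LocallyCompactSpace M] in
/-- The value of `π₂^♯ b_β` on a simplex. [folklore] -/
theorem prodFun_apply (β : closedSmoothForms I' N ℝ l) (σ : SingularSimplex (M × N) l) :
    prodFun M β σ = goodFun β (σ.map (sndCM M N)) :=
  singularCochainComplex.map_apply _ _ _

variable (N) in
/-- **The left-hand side `Ψ'_{π₁⁻¹ W} [π₁^* η ∧ π₂^* β]`**: the de Rham comparison of the external
product with `β`. [cite: Bredon1993, Thm. V.9.5] -/
def lhs {W : Set M} (hW : IsOpen W) (β : closedSmoothForms I' N ℝ l) (k n : ℕ) (h : k + l = n) :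
    (localDeRhamComplex I ℝ hW).homology k →ₗ[ℝ]
      (subsetCochains ℝ realCoeff.{u} (Prod.fst ⁻¹' W : Set (M × N))).homology n :=
  (ModuleCat.Hom.hom (localDeRhamToSubset (I.prod I') (isOpen_preimage_fst (N := N) hW) n)) ∘ₗ
    localDeRhamComplex.extProdH N hW β k n h

variable (N) in
/-- **The right-hand side `π₁^*(Ψ'_W [η]) ⌣ π₂^♯ b_β`.** [cite: Bredon1993, Thm. V.9.5] -/
def rhs {W : Set M} (hW : IsOpen W) (β : closedSmoothForms I' N ℝ l) (k n : ℕ) (h : k + l = n) :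
    (localDeRhamComplex I ℝ hW).homology k →ₗ[ℝ]
      (subsetCochains ℝ realCoeff.{u} (Prod.fst ⁻¹' W : Set (M × N))).homology n :=
  (SimplexSpan.ofSet (R := ℝ) (Prod.fst ⁻¹' W : Set (M × N))).cupRightH (SimplexSpan.frontBackClosed_ofSet _)
      (prodFun M β) (d_prodFun β) h ∘ₗ
    (ModuleCat.Hom.hom (subsetCochains.pullH (N := realCoeff.{u}) (fstCM M N) (mapsTo_preimage Prod.fst W) k) ∘ₗ
      ModuleCat.Hom.hom (localDeRhamToSubset I hW k))

/-- Unfolding `lhs`. [folklore] -/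
theorem lhs_apply {W : Set M} (hW : IsOpen W) (β : closedSmoothForms I' N ℝ l) (h : k + l = n)
    (a : (localDeRhamComplex I ℝ hW).homology k) :
    lhs N hW β k n h a = localDeRhamToSubset (I.prod I') (isOpen_preimage_fst (N := N) hW) n
      (localDeRhamComplex.extProdH N hW β k n h a) := rfl

/-- Unfolding `rhs`. [folklore] -/
theorem rhs_apply {W : Set M} (hW : IsOpen W) (β : closedSmoothForms I' N ℝ l) (h : k + l = n)
    (a : (localDeRhamComplex I ℝ hW).homology k) :
    rhs N hW β k n h a =
      (SimplexSpan.ofSet (R := ℝ) (Prod.fst ⁻¹' W : Set (M × N))).cupRightH (SimplexSpan.frontBackClosed_ofSet _)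
        (prodFun M β) (d_prodFun β) h
        (subsetCochains.pullH (N := realCoeff.{u}) (fstCM M N) (mapsTo_preimage Prod.fst W) k
          (localDeRhamToSubset I hW k a)) := rfl

/-! ### Naturality under restriction -/

/-- **`lhs` commutes with restriction to a smaller open set.** [cite: Bredon1993, Thm. V.9.5] -/
theorem lhs_res {U W : Set M} (hU : IsOpen U) (hW : IsOpen W) (hUW : U ⊆ W) (β : closedSmoothForms I' N ℝ l)
    (h : k + l = n) (a : (localDeRhamComplex I ℝ hW).homology k) :
    lhs N hU β k n h (HomologicalComplex.homologyMap (localDeRhamComplex.res I ℝ hU hW hUW) k a) =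
      subsetCochains.resH (preimage_mono hUW) n (lhs N hW β k n h a) := by
  rw [lhs_apply, lhs_apply, localDeRhamComplex.extProdH_res hU hW hUW β h a, localDeRhamToSubset_res_apply]

/-- **`rhs` commutes with restriction to a smaller open set.** [cite: Bredon1993, Thm. V.9.5] -/
theorem rhs_res {U W : Set M} (hU : IsOpen U) (hW : IsOpen W) (hUW : U ⊆ W) (β : closedSmoothForms I' N ℝ l)
    (h : k + l = n) (a : (localDeRhamComplex I ℝ hW).homology k) :
    rhs N hU β k n h (HomologicalComplex.homologyMap (localDeRhamComplex.res I ℝ hU hW hUW) k a) =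
      subsetCochains.resH (preimage_mono hUW) n (rhs N hW β k n h a) := by
  rw [rhs_apply, rhs_apply, localDeRhamToSubset_res_apply]
  have h1 : subsetCochains.pullH (N := realCoeff.{u}) (fstCM M N) (mapsTo_preimage Prod.fst U) k
      (subsetCochains.resH hUW k (localDeRhamToSubset I hW k a)) =
      subsetCochains.resH (preimage_mono hUW) k
        (subsetCochains.pullH (N := realCoeff.{u}) (fstCM M N) (mapsTo_preimage Prod.fst W) k
          (localDeRhamToSubset I hW k a)) := by
    rw [← ModuleCat.comp_apply, subsetCochains.resH_comp_pullH (fstCM M N) (preimage_mono hUW) hUW,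
      ModuleCat.comp_apply]
  rw [h1]
  exact ((SimplexSpan.ofSet (R := ℝ) (Prod.fst ⁻¹' W : Set (M × N))).homologyMap_dualMap_cupRightH
    (SimplexSpan.frontBackClosed_ofSet _) (prodFun M β) (d_prodFun β)
    (SimplexSpan.ofSet (R := ℝ) (Prod.fst ⁻¹' U : Set (M × N))) (chainsInSub_mono ℝ ℝ (preimage_mono hUW))
    (SimplexSpan.frontBackClosed_ofSet _) (fun hσ ↦ hσ.trans (preimage_mono hUW)) h _).symm

/-! ### Mayer–Vietoris -/

/-- **`lhs` commutes with the Mayer–Vietoris connecting homomorphisms.** [cite: Bredon1993, Thm. V.9.5] -/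
theorem lhs_δ {A B : Set M} (hA : IsOpen A) (hB : IsOpen B) (β : closedSmoothForms I' N ℝ l) (h : k + l = n)
    (y : (localDeRhamComplex I ℝ (hA.inter hB)).homology k) :
    subsetCochains.mvδ ℝ realCoeff.{u} (isOpen_preimage_fst (N := N) hA) (isOpen_preimage_fst (N := N) hB) n
        (lhs N (hA.inter hB) β k n h y) =
      lhs N (hA.union hB) β (k + 1) (n + 1) (by omega)
        ((localDeRhamComplex.mvShortComplex_shortExact (I := I) (F := ℝ) (hA := hA) (hB := hB)).δ k (k + 1)
          (crel k) y) := by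
  rw [lhs_apply, lhs_apply, ← localDeRhamComplex.extProdH_δ hA hB β h y]
  exact (localDeRhamToSubset_δ_apply (isOpen_preimage_fst (N := N) hA) (isOpen_preimage_fst (N := N) hB) n _).symm

/-- **`rhs` commutes with the Mayer–Vietoris connecting homomorphisms.** [cite: Bredon1993, Thm. V.9.5] -/
theorem rhs_δ {A B : Set M} (hA : IsOpen A) (hB : IsOpen B) (β : closedSmoothForms I' N ℝ l) (h : k + l = n)
    (y : (localDeRhamComplex I ℝ (hA.inter hB)).homology k) :
    subsetCochains.mvδ ℝ realCoeff.{u} (isOpen_preimage_fst (N := N) hA) (isOpen_preimage_fst (N := N) hB) n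
        (rhs N (hA.inter hB) β k n h y) =
      rhs N (hA.union hB) β (k + 1) (n + 1) (by omega)
        ((localDeRhamComplex.mvShortComplex_shortExact (I := I) (F := ℝ) (hA := hA) (hB := hB)).δ k (k + 1)
          (crel k) y) := by
  rw [rhs_apply, rhs_apply, localDeRhamToSubset_δ_apply]
  refine (subsetCochains.mvδ_cupRightH (prodFun M β) (d_prodFun β) (isOpen_preimage_fst (N := N) hA)
    (isOpen_preimage_fst (N := N) hB) h _).trans ?_
  congr 1
  have hnat := subsetCochains.mvδ_pull (R := ℝ) (N := realCoeff.{u}) (fstCM M N) A B hA hB k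
  have e := congrArg (fun φ ↦ (ModuleCat.Hom.hom φ) (localDeRhamToSubset I (hA.inter hB) k y)) hnat
  simp only [ModuleCat.hom_comp, LinearMap.comp_apply] at e
  exact e.symm

/-! ### Congruence helpers -/

omit [IsManifold I ∞ M] [I.Boundaryless] [FiniteDimensional ℝ E] [T2Space M] [SecondCountableTopology M]
  [LocallyCompactSpace M] in
/-- `cupRightH` only depends on the cocycle (proof-irrelevance helper). [folklore] -/
theorem cupRightH_congr_cocycle {X : Type u} [TopologicalSpace X] (𝒮 : SimplexSpan ℝ X) (hS : 𝒮.FrontBackClosed)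
    {p d n : ℕ} {b b' : SingularSimplex X d → ℝ} (hb : (singularCochainComplex ℝ ℝ X).d d (d + 1) b = 0)
    (hb' : (singularCochainComplex ℝ ℝ X).d d (d + 1) b' = 0) (e : b = b') (h : p + d = n)
    (x : 𝒮.cochains.homology p) : 𝒮.cupRightH hS b hb h x = 𝒮.cupRightH hS b' hb' h x := by
  subst e
  rfl

omit [IsManifold I ∞ M] [I.Boundaryless] [FiniteDimensional ℝ E] [T2Space M] [SecondCountableTopology M]
  [LocallyCompactSpace M] in
/-- `pullH` only depends on the continuous map (proof-irrelevance helper). [folklore] -/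
theorem pullH_congr_map {X Y : Type u} [TopologicalSpace X] [TopologicalSpace Y] {f f' : C(X, Y)} (e : f = f')
    {U : Set X} {V : Set Y} (hf : MapsTo f U V) (hf' : MapsTo f' U V) (p : ℕ)
    (y : (subsetCochains ℝ realCoeff.{u} V).homology p) :
    subsetCochains.pullH (N := realCoeff.{u}) f hf p y = subsetCochains.pullH (N := realCoeff.{u}) f' hf' p y := by
  subst e
  rfl

/-! ### Naturality in the first factor (maps of pairs) -/

section FirstFactor

variable {E₁ : Type u} [NormedAddCommGroup E₁] [NormedSpace ℝ E₁] {H₁ : Type u} [TopologicalSpace H₁]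
  {I₁ : ModelWithCorners ℝ E₁ H₁} {M₁ : Type u} [TopologicalSpace M₁] [ChartedSpace H₁ M₁] [IsManifold I₁ ∞ M₁]
  [I₁.Boundaryless] [FiniteDimensional ℝ E₁] [T2Space M₁] [SecondCountableTopology M₁] [LocallyCompactSpace M₁]
  {f : M₁ → M} (hf : ContMDiff I₁ I ∞ f) {W₁ : Set M₁} (hW₁ : IsOpen W₁) {W : Set M} (hW : IsOpen W)
  (hfW : MapsTo f W₁ W) (β : closedSmoothForms I' N ℝ l)

omit [ChartedSpace H' N] in
/-- `f × id` as a continuous map. [folklore] -/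
abbrev prodMapIdCM (hf : ContMDiff I₁ I ∞ f) : C(M₁ × N, M × N) :=
  ⟨Prod.map f (id : N → N), hf.continuous.prodMap continuous_id⟩

/-- **`lhs` is natural for maps of pairs in the first factor**:
`lhs_{W₁} (((f^*)|) a) = (f × id)^* (lhs_W a)`. [cite: Bredon1993, Thm. V.9.5] -/
theorem lhs_pullbackPair (h : k + l = n) (a : (localDeRhamComplex I ℝ hW).homology k) :
    lhs N hW₁ β k n h (HomologicalComplex.homologyMap (localDeRhamComplex.pullbackPair I₁ hf hW₁ hW hfW) k a) =
      subsetCochains.pullH (N := realCoeff.{u}) (prodMapIdCM hf) (mapsTo_prodMap_id hfW) n (lhs N hW β k n h a) := by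
  rw [lhs_apply, lhs_apply, localDeRhamComplex.extProdH_pullbackPair hf hW₁ hW hfW β h a,
    localDeRhamToSubset_pullbackPair_apply]

omit [IsManifold I ∞ M] [I.Boundaryless] [FiniteDimensional ℝ E] [T2Space M] [SecondCountableTopology M]
  [LocallyCompactSpace M] [IsManifold I₁ ∞ M₁] [I₁.Boundaryless] [FiniteDimensional ℝ E₁] [T2Space M₁]
  [SecondCountableTopology M₁] [LocallyCompactSpace M₁] in
/-- `(f × id)^♯ (π₂^♯ b_β) = π₂^♯ b_β` (on `M₁ × N`). [folklore] -/
theorem map_prodMapId_prodFun :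
    (singularCochainComplex.map ℝ ℝ (prodMapIdCM (N := N) hf)).f l (prodFun M β) = prodFun M₁ β := by
  funext σ
  rw [singularCochainComplex.map_apply, prodFun_apply, prodFun_apply, ← SingularSimplex.map_comp]
  rfl

omit [IsManifold I ∞ M] [I.Boundaryless] [FiniteDimensional ℝ E] [T2Space M] [SecondCountableTopology M]
  [LocallyCompactSpace M] [IsManifold I' ∞ N] [I'.Boundaryless] [FiniteDimensional ℝ E'] [T2Space N]
  [SecondCountableTopology N] [LocallyCompactSpace N] [IsManifold I₁ ∞ M₁] [I₁.Boundaryless]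
  [FiniteDimensional ℝ E₁] [T2Space M₁] [SecondCountableTopology M₁] [LocallyCompactSpace M₁] in
/-- `π₁^* ∘ f^* = (f × id)^* ∘ π₁^*` on the cohomology of chains in subsets. [folklore] -/
theorem pullH_fst_pullH (p : ℕ) (y : (subsetCochains ℝ realCoeff.{u} W).homology p) :
    subsetCochains.pullH (N := realCoeff.{u}) (fstCM M₁ N) (mapsTo_preimage Prod.fst W₁) p
        (subsetCochains.pullH (N := realCoeff.{u}) ⟨f, hf.continuous⟩ hfW p y) =
      subsetCochains.pullH (N := realCoeff.{u}) (prodMapIdCM hf) (mapsTo_prodMap_id hfW) p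
        (subsetCochains.pullH (N := realCoeff.{u}) (fstCM M N) (mapsTo_preimage Prod.fst W) p y) := by
  rw [subsetCochains.pullH_pullH _ _ _ _ (show MapsTo ((⟨f, hf.continuous⟩ : C(M₁, M)).comp (fstCM M₁ N))
      (Prod.fst ⁻¹' W₁) W from fun _ hp ↦ hfW hp),
    subsetCochains.pullH_pullH _ _ _ _ (show MapsTo ((fstCM M N).comp (prodMapIdCM (N := N) hf))
      (Prod.fst ⁻¹' W₁) W from fun _ hp ↦ hfW hp)]
  exact pullH_congr_map rfl _ _ p y

/-- **`rhs` is natural for maps of pairs in the first factor**: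
`rhs_{W₁} (((f^*)|) a) = (f × id)^* (rhs_W a)`. [cite: HatcherAT2002, §3.2 Prop. 3.10] -/
theorem rhs_pullbackPair (h : k + l = n) (a : (localDeRhamComplex I ℝ hW).homology k) :
    rhs N hW₁ β k n h (HomologicalComplex.homologyMap (localDeRhamComplex.pullbackPair I₁ hf hW₁ hW hfW) k a) =
      subsetCochains.pullH (N := realCoeff.{u}) (prodMapIdCM hf) (mapsTo_prodMap_id hfW) n (rhs N hW β k n h a) := by
  rw [rhs_apply, rhs_apply, localDeRhamToSubset_pullbackPair_apply, subsetCochains.pullH_cupRightH,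
    pullH_fst_pullH hf hfW]
  exact cupRightH_congr_cocycle _ _ _ _ (map_prodMapId_prodFun hf β).symm h _

end FirstFactor

/-! ### Naturality in the second factor (maps of pairs) -/

section SecondFactor

variable {E₂ : Type u} [NormedAddCommGroup E₂] [NormedSpace ℝ E₂] {H₂ : Type u} [TopologicalSpace H₂]
  {I₂ : ModelWithCorners ℝ E₂ H₂} {N₂ : Type u} [TopologicalSpace N₂] [ChartedSpace H₂ N₂] [IsManifold I₂ ∞ N₂]
  [I₂.Boundaryless] [FiniteDimensional ℝ E₂] [T2Space N₂] [SecondCountableTopology N₂] [LocallyCompactSpace N₂]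
  {g : N₂ → N} (hg : ContMDiff I₂ I' ∞ g) {W : Set M} (hW : IsOpen W) (β : closedSmoothForms I' N ℝ l)

omit [ChartedSpace H M] in
/-- `id × g` as a continuous map. [folklore] -/
abbrev idProdMapCM (hg : ContMDiff I₂ I' ∞ g) : C(M × N₂, M × N) :=
  ⟨Prod.map (id : M → M) g, continuous_id.prodMap hg.continuous⟩

/-- **`lhs` is natural in the second factor**: `lhs^{g^*β}_W a = (id × g)^* (lhs^β_W a)`.
[cite: Bredon1993, Thm. V.9.5] -/
theorem lhs_pullbackPair_snd (h : k + l = n) (a : (localDeRhamComplex I ℝ hW).homology k) :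
    lhs N₂ hW (pullbackClosed hg β) k n h a =
      subsetCochains.pullH (N := realCoeff.{u}) (idProdMapCM hg) (mapsTo_id_prodMap g W) n (lhs N hW β k n h a) := by
  rw [lhs_apply, lhs_apply, localDeRhamComplex.extProdH_pullbackPair_snd hg hW β h a,
    localDeRhamToSubset_pullbackPair_apply]

omit [IsManifold I ∞ M] [I.Boundaryless] [FiniteDimensional ℝ E] [T2Space M] [SecondCountableTopology M]
  [LocallyCompactSpace M] [I'.Boundaryless] [FiniteDimensional ℝ E'] [T2Space N] [SecondCountableTopology N]
  [LocallyCompactSpace N] [I₂.Boundaryless] [FiniteDimensional ℝ E₂] [T2Space N₂] [SecondCountableTopology N₂]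
  [LocallyCompactSpace N₂] in
/-- The class of `g^* β` in `Hˡ(Ω•(N₂))` is the pull-back of the class of `β`. [folklore] -/
theorem closedToLocalHomology_pullbackClosed :
    closedToLocalHomology I₂ N₂ ℝ l (pullbackClosed hg β) =
      HomologicalComplex.homologyMap (localDeRhamComplex.pullbackInto I₂ hg isOpen_univ (fun _ ↦ mem_univ _)) l
        (closedToLocalHomology I' N ℝ l β) := by
  have e1 : closedToLocalHomology I' N ℝ l β = homologyCls (closedToUniv I' N ℝ l β) (d_closedToUniv β) := rfl
  have e2 : closedToLocalHomology I₂ N₂ ℝ l (pullbackClosed hg β) =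
      homologyCls (closedToUniv I₂ N₂ ℝ l (pullbackClosed hg β)) (d_closedToUniv _) := rfl
  rw [e1, e2, homologyMap_homologyCls]
  exact homologyCls_congr (Subtype.ext rfl) _ _

omit [IsManifold I ∞ M] [I.Boundaryless] [FiniteDimensional ℝ E] [T2Space M] [SecondCountableTopology M]
  [LocallyCompactSpace M] in
/-- **The good representatives of `g^* β` and of `β` are compatible up to a coboundary**:
`b_{g^*β} - g^♯ b_β = δ w`. [cite: Bredon1993, Thm. V.9.5] -/
theorem exists_goodRep_pullbackClosed_sub_eq_d :
    ∃ w : (subsetCochains ℝ realCoeff.{u} (univ : Set N₂)).X ((ComplexShape.down ℕ).symm.prev l),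
      (subsetCochains ℝ realCoeff.{u} (univ : Set N₂)).d _ l w =
        goodRep (pullbackClosed hg β) -
          (subsetCochains.pull ℝ realCoeff.{u} ⟨g, hg.continuous⟩ (mapsTo_univ_of_forall_mem fun _ ↦ mem_univ _)).f l
            (goodRep β) := by
  refine (homologyCls_eq_homologyCls_iff _ _ (d_goodRep _) (d_hom_f_eq_zero _ _ (d_goodRep β))).1 ?_
  have h2 : homologyCls ((subsetCochains.pull ℝ realCoeff.{u} ⟨g, hg.continuous⟩
      (mapsTo_univ_of_forall_mem fun _ ↦ mem_univ _)).f l (goodRep β)) (d_hom_f_eq_zero _ _ (d_goodRep β)) =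
      subsetCochains.pullH (N := realCoeff.{u}) ⟨g, hg.continuous⟩ (mapsTo_univ_of_forall_mem fun _ ↦ mem_univ _) l
        (comparisonCls β) := by
    rw [← homologyCls_goodRep]
    exact (homologyMap_homologyCls _ _ _).symm
  rw [h2, homologyCls_goodRep]
  change localDeRhamToSubset I₂ isOpen_univ l (closedToLocalHomology I₂ N₂ ℝ l (pullbackClosed hg β)) =
    subsetCochains.pullH (N := realCoeff.{u}) ⟨g, hg.continuous⟩ (mapsTo_univ_of_forall_mem fun _ ↦ mem_univ _) l
      (localDeRhamToSubset I' isOpen_univ l (closedToLocalHomology I' N ℝ l β))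
  rw [closedToLocalHomology_pullbackClosed hg β, localDeRhamToSubset_pullbackInto_apply]

omit [IsManifold I ∞ M] [I.Boundaryless] [FiniteDimensional ℝ E] [T2Space M] [SecondCountableTopology M]
  [LocallyCompactSpace M] [IsManifold I₂ ∞ N₂] [I₂.Boundaryless] [FiniteDimensional ℝ E₂] [T2Space N₂]
  [SecondCountableTopology N₂] [LocallyCompactSpace N₂] in
/-- The function cochain of `g^♯ b` is `g^♯` of the function cochain. [folklore] -/
theorem toFun_pull_goodRep :
    (SimplexSpan.ofSet (R := ℝ) (univ : Set N₂)).toFun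
        ((subsetCochains.pull ℝ realCoeff.{u} ⟨g, hg.continuous⟩ (mapsTo_univ_of_forall_mem fun _ ↦ mem_univ _)).f l
          (goodRep β)) =
      (singularCochainComplex.map ℝ ℝ ⟨g, hg.continuous⟩).f l (goodFun β) := by
  funext σ
  rw [subsetCochains.toFun_pull _ _ _ (subset_univ _), singularCochainComplex.map_apply]
  rfl

omit [IsManifold I ∞ M] [I.Boundaryless] [FiniteDimensional ℝ E] [T2Space M] [SecondCountableTopology M]
  [LocallyCompactSpace M] [IsManifold I' ∞ N] [I'.Boundaryless] [FiniteDimensional ℝ E'] [T2Space N]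
  [SecondCountableTopology N] [LocallyCompactSpace N] [IsManifold I₂ ∞ N₂] [I₂.Boundaryless]
  [FiniteDimensional ℝ E₂] [T2Space N₂] [SecondCountableTopology N₂] [LocallyCompactSpace N₂] [ChartedSpace H M]
  [ChartedSpace H' N] [ChartedSpace H₂ N₂] in
/-- `(id × g)^♯ π₂^♯ c = π₂^♯ g^♯ c`. [folklore] -/
theorem map_idProdMap_map_snd (hgc : Continuous g) (c : SingularSimplex N l → ℝ) :
    (singularCochainComplex.map ℝ ℝ (⟨Prod.map (id : M → M) g, continuous_id.prodMap hgc⟩ : C(M × N₂, M × N))).f l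
        ((singularCochainComplex.map ℝ ℝ (sndCM M N)).f l c) =
      (singularCochainComplex.map ℝ ℝ (sndCM M N₂)).f l ((singularCochainComplex.map ℝ ℝ ⟨g, hgc⟩).f l c) := by
  funext σ
  simp only [singularCochainComplex.map_apply, ← SingularSimplex.map_comp]
  rfl

omit [IsManifold I ∞ M] [I.Boundaryless] [FiniteDimensional ℝ E] [T2Space M] [SecondCountableTopology M]
  [LocallyCompactSpace M] [ChartedSpace H M] in
/-- **`π₂^♯ b_{g^*β}` and `(id × g)^♯ π₂^♯ b_β` are cohomologous** (positive degree). [cite: Bredon1993, Thm. V.9.5] -/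
theorem exists_prodFun_pullbackClosed_sub_eq_d {l' : ℕ} (hl : l' + 1 = l) :
    ∃ α : SingularSimplex (M × N₂) l' → ℝ, ∀ b' : SingularSimplex (M × N₂) l → ℝ,
      b' = (singularCochainComplex.map ℝ ℝ (idProdMapCM (M := M) hg)).f l (prodFun M β) →
        prodFun M (pullbackClosed hg β) - b' = (singularCochainComplex ℝ ℝ (M × N₂)).d l' l α := by
  subst hl
  obtain ⟨w, hw⟩ := exists_goodRep_pullbackClosed_sub_eq_d hg β
  refine ⟨(singularCochainComplex.map ℝ ℝ (sndCM M N₂)).f l' ((SimplexSpan.ofSet (R := ℝ) (univ : Set N₂)).toFun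
    ((HomologicalComplex.XIsoOfEq (subsetCochains ℝ realCoeff.{u} (univ : Set N₂))
      (SimplexSpan.symm_down_prev_succ l')).hom w)), ?_⟩
  rintro b' rfl
  rw [← ModuleCat.comp_apply, (singularCochainComplex.map ℝ ℝ (sndCM M N₂)).comm l' (l' + 1), ModuleCat.comp_apply]
  obtain ⟨c, hc⟩ : ∃ c : SingularSimplex N₂ (l' + 1) → ℝ,
      c = (singularCochainComplex.map ℝ ℝ ⟨g, hg.continuous⟩).f (l' + 1) (goodFun β) := ⟨_, rfl⟩
  have hd : (singularCochainComplex ℝ ℝ N₂).d l' (l' + 1) ((SimplexSpan.ofSet (R := ℝ) (univ : Set N₂)).toFun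
      ((HomologicalComplex.XIsoOfEq (subsetCochains ℝ realCoeff.{u} (univ : Set N₂))
        (SimplexSpan.symm_down_prev_succ l')).hom w)) = goodFun (pullbackClosed hg β) - c := by
    funext τ
    rw [← (SimplexSpan.ofSet (R := ℝ) (univ : Set N₂)).toFun_d _ (subset_univ _)]
    have hw' : (SimplexSpan.ofSet (R := ℝ) (univ : Set N₂)).cochains.d l' (l' + 1)
        ((HomologicalComplex.XIsoOfEq (subsetCochains ℝ realCoeff.{u} (univ : Set N₂))
          (SimplexSpan.symm_down_prev_succ l')).hom w) =
        goodRep (pullbackClosed hg β) -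
          (subsetCochains.pull ℝ realCoeff.{u} ⟨g, hg.continuous⟩ (mapsTo_univ_of_forall_mem fun _ ↦ mem_univ _)).f (l' + 1)
            (goodRep β) := by
      rw [← hw]
      exact congrArg (fun φ ↦ (ModuleCat.Hom.hom φ) w)
        ((subsetCochains ℝ realCoeff.{u} (univ : Set N₂)).XIsoOfEq_hom_comp_d (SimplexSpan.symm_down_prev_succ l') (l' + 1))
    rw [hw', SimplexSpan.toFun_sub, hc, ← toFun_pull_goodRep hg β]
    rfl
  rw [hd, map_sub, prodFun, prodFun, map_idProdMap_map_snd (M := M) hg.continuous, hc]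

omit [IsManifold I ∞ M] [I.Boundaryless] [FiniteDimensional ℝ E] [T2Space M] [SecondCountableTopology M]
  [LocallyCompactSpace M] [IsManifold I' ∞ N] [I'.Boundaryless] [FiniteDimensional ℝ E'] [T2Space N]
  [SecondCountableTopology N] [LocallyCompactSpace N] [IsManifold I₂ ∞ N₂] [I₂.Boundaryless]
  [FiniteDimensional ℝ E₂] [T2Space N₂] [SecondCountableTopology N₂] [LocallyCompactSpace N₂] [ChartedSpace H₂ N₂] in
/-- `π₁^* = (id × g)^* ∘ π₁^*` on the cohomology of chains in subsets. [folklore] -/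
theorem pullH_idProdMap_pullH_fst (hgc : Continuous g) (p : ℕ) (y : (subsetCochains ℝ realCoeff.{u} W).homology p) :
    subsetCochains.pullH (N := realCoeff.{u}) (⟨Prod.map (id : M → M) g, continuous_id.prodMap hgc⟩ : C(M × N₂, M × N))
        (mapsTo_id_prodMap g W) p (subsetCochains.pullH (N := realCoeff.{u}) (fstCM M N) (mapsTo_preimage Prod.fst W) p y) =
      subsetCochains.pullH (N := realCoeff.{u}) (fstCM M N₂) (mapsTo_preimage Prod.fst W) p y := by
  rw [subsetCochains.pullH_pullH _ _ _ _ (show MapsTo ((fstCM M N).comp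
      (⟨Prod.map (id : M → M) g, continuous_id.prodMap hgc⟩ : C(M × N₂, M × N))) (Prod.fst ⁻¹' W) W from fun _ hp ↦ hp)]
  exact pullH_congr_map rfl _ _ p y

/-- **`rhs` is natural in the second factor**: `rhs^{g^*β}_W a = (id × g)^* (rhs^β_W a)`.
[cite: HatcherAT2002, §3.2 Prop. 3.10, Lemma 3.6] -/
theorem rhs_pullbackPair_snd (h : k + l = n) (a : (localDeRhamComplex I ℝ hW).homology k) :
    rhs N₂ hW (pullbackClosed hg β) k n h a =
      subsetCochains.pullH (N := realCoeff.{u}) (idProdMapCM hg) (mapsTo_id_prodMap g W) n (rhs N hW β k n h a) := by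
  rw [rhs_apply, rhs_apply, subsetCochains.pullH_cupRightH, pullH_idProdMap_pullH_fst hg.continuous]
  -- change the cocycle
  rcases Nat.eq_zero_or_pos l with rfl | hl
  · -- degree `0`: cohomologous `0`-cocycles are equal
    refine cupRightH_congr_cocycle _ _ _ _ ?_ h _
    obtain ⟨w, hw⟩ := exists_goodRep_pullbackClosed_sub_eq_d hg β
    have h0 : (subsetCochains ℝ realCoeff.{u} (univ : Set N₂)).d _ 0 w = 0 := by
      rw [(subsetCochains ℝ realCoeff.{u} (univ : Set N₂)).shape _ _ (by
        simp only [ComplexShape.symm_Rel, ComplexShape.down_Rel]; omega)]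
      rfl
    rw [h0, eq_comm, sub_eq_zero] at hw
    rw [prodFun, prodFun, map_idProdMap_map_snd (M := M) hg.continuous, ← toFun_pull_goodRep hg β, ← hw]
    rfl
  · obtain ⟨l', rfl⟩ : ∃ l', l = l' + 1 := ⟨l - 1, by omega⟩
    obtain ⟨α, hα⟩ := exists_prodFun_pullbackClosed_sub_eq_d (M := M) hg β (l' := l') rfl
    exact (SimplexSpan.ofSet (R := ℝ) _).cupRightH_congr (SimplexSpan.frontBackClosed_ofSet _) _ _ _ _ α (hα _ rfl) h _

end SecondFactor

end Sides

end Literature.Geometry.Manifold
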